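import Summits.HodgeConjecture.CorCM.GaloisImaginaryQuadraticClassification
import Summits.HodgeConjecture.CorCM.GaloisDodecicBinders
import HarnessLib

/-!
# Simple abelian varieties with an action of a Galois CM field containing an imaginary quadratic field, good
# Galois types: the Hodge conjecture for everything isogenous to a power — intrinsic forms and class-target displays

COR-CM (cell `pub-hodgecm2`), binder seat b04 (gen 19), count-neutral claim GALOIS-TWICE-ODD, part X (the binders of
the capstone `GaloisImaginaryQuadraticClassification`, in the format of gen 14's `GaloisDodecicBinders`).  KERNEL
ONLY: theorems; no definition, no named fact, no `sorry`.  `HC_CM` is neither used nor claimed: every statement is the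
Hodge conjecture for a NAMED class of complex abelian varieties, UNCONDITIONALLY.

The type-level theorems of part IX take a realisation `(A, ι, θ)` of a CM type.  Here they are read on a SIMPLE complex
abelian variety `X` with `φ : F →+* End⁰(X)` from a Galois CM field `F ⊇ k` (imaginary quadratic), `dim X = [F : k]`,
of GOOD Galois type `Gal(F/k) ∈ {1, C₂, C₂², C₄, C₂³, C_p, S₃}` — via Shimura's principal model in the isogeny class
(`exists_principal_pair`), the CM type of the pair (`isCMTypeRealisation_cmTypeOfPair`), simplicity along isogenies and
the isogeny invariance of `B = D` (van Geemen 3.7):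

* **`hodgeConjectureFor_of_isIsogenous_powSucc_of_ringHom_of_quadratic_of_good`** — every complex abelian variety
  isogenous to a power `X^{N+1}` is divisor-generated and satisfies the Hodge conjecture;
* **`hcOnClass_isIsogenous_powSucc_simple_galoisCM_imaginaryQuadratic_good`** — the class-target display;
* §0 **`forall_isPrimitive_isNondegenerate_iff_of_subgroup`** — the classification in GROUP form (an index-`2` subgroup
  `H ∌ c`, i.e. `Gal(F/ℚ) = ⟨c⟩ × H`, cuts out an imaginary quadratic subfield `F^H`, `exists_quadratic_of_subgroup`).

By part IX the list of Galois types is COMPLETE: for every other `Gal(F/k)` some simple abelian variety of dimension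
`[F:k]` with CM by `F` is degenerate (exceptional Hodge classes), so no such unconditional statement can hold for it by
this route.

## References

* [Shimura1998] G. Shimura, *Abelian Varieties with Complex Multiplication and Modular Functions*, §5.2, §7.1 Prop. 7,
  §8.2 Prop. 26.
* [vanGeemen1994HodgeAV] B. van Geemen, LNM 1594 (1994), Lemma 3.7.
* [Gordon1999HodgeAVSurvey] B. B. Gordon, Thm. 6.3–6.4, §9.4.
* [Deligne2000] P. Deligne, *The Hodge conjecture* (Clay, 2000), §1.
* [Dodson1984] B. Dodson, Trans. AMS 283 (1984), §3.1.1, §4.1.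
-/

noncomputable section

open CategoryTheory CategoryTheory.Limits NumberField

namespace Summit.HodgeConjecture.CorCM.TwiceOdd

open Literature.NumberTheory.ComplexMultiplication
open Literature.AlgebraicGeometry Literature.AlgebraicGeometry.Motives Literature.AlgebraicGeometry.HodgeTheory
open Literature.AlgebraicGeometry.Motives.AbelianVariety
open Literature.AlgebraicGeometry.ComplexMultiplication
open Literature.AlgebraicGeometry.Pohlmann1968
open Summit.HodgeConjecture.HodgeConjecture.Ring2.ClassTargets

variable {F : Type} [Field F] [NumberField F] [IsCMField F]

/-! ### §0 Group-theoretic form: an index-`2` subgroup avoiding `c` cuts out an imaginary quadratic subfield -/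

/-- **A subgroup `H ≤ Gal(F/ℚ)` with `c ∉ H` and `G = H ∪ cH` is `Gal(F/k)` for an imaginary quadratic subfield `k`**
(`k = F^H`: `[Gal : H] = 2`, so `[k : ℚ] = 2`, and `c ∉ H = Gal(F/k)` moves `k`, so `k` has a complex place).
[folklore] -/
theorem exists_quadratic_of_subgroup [IsGalois ℚ F] (H : Subgroup (F ≃ₐ[ℚ] F))
    (hcH : (IsCMField.complexConj F).restrictScalars ℚ ∉ H)
    (hH : ∀ g : F ≃ₐ[ℚ] F, g ∈ H ∨ (IsCMField.complexConj F).restrictScalars ℚ * g ∈ H) :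
    ∃ k : IntermediateField ℚ F, k.fixingSubgroup = H ∧ Module.finrank ℚ k = 2 ∧ Module.finrank k F = Nat.card H ∧
      ∃ τ₀ : k →+* ℂ, ComplexEmbedding.conjugate τ₀ ≠ τ₀ := by
  set c : F ≃ₐ[ℚ] F := (IsCMField.complexConj F).restrictScalars ℚ with hc_def
  set k : IntermediateField ℚ F := IntermediateField.fixedField H with hk_def
  have hfix : k.fixingSubgroup = H := IntermediateField.fixingSubgroup_fixedField H
  have hkF : Module.finrank k F = Nat.card H := IntermediateField.finrank_fixedField_eq_card H
  -- `[Gal : H] = 2`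
  have hidx : H.index = 2 := by
    rw [Subgroup.index_eq_two_iff]
    refine ⟨c, fun b => ?_⟩
    by_cases hb : b ∈ H
    · refine Or.inr ⟨hb, fun hbc => hcH ?_⟩
      simpa using H.mul_mem (H.inv_mem hb) hbc
    · refine Or.inl ⟨?_, hb⟩
      rw [← Summit.HodgeConjecture.CorCM.GaloisOctic.complexConj_mul_comm b]
      exact (hH b).resolve_left hb
  have hk2 : Module.finrank ℚ k = 2 := by
    have h1 := H.index_mul_card
    rw [hidx, IsGalois.card_aut_eq_finrank, ← Module.finrank_mul_finrank ℚ k F, hkF] at h1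
    have hpos : 0 < Nat.card H := Nat.card_pos
    exact Nat.eq_of_mul_eq_mul_right hpos h1.symm
  -- a complex place: otherwise `c` fixes `k` pointwise
  obtain ⟨φ₀⟩ := (inferInstance : Nonempty (F →+* ℂ))
  refine ⟨k, hfix, hk2, hkF, φ₀.comp (algebraMap k F), fun hreal => hcH ?_⟩
  rw [← hfix, IntermediateField.mem_fixingSubgroup_iff]
  intro x hx
  apply φ₀.injective
  have h := RingHom.congr_fun hreal ⟨x, hx⟩
  rw [ComplexEmbedding.conjugate_coe_eq, RingHom.comp_apply] at h
  change starRingEnd ℂ (φ₀ x) = φ₀ x at h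
  rw [AlgEquiv.restrictScalars_apply, IsCMField.complexEmbedding_complexConj]
  exact h

/-- **The classification in group-theoretic form.**  `F/ℚ` Galois CM, `H ≤ Gal(F/ℚ)` with `c ∉ H` and `G = H ∪ cH`
(equivalently: `F` contains an imaginary quadratic field, `H` its fixing group): every primitive CM type of `F` is
nondegenerate ⟺ `|H|` prime ∨ `|H| = 1` ∨ `|H| = 4` ∨ (`|H| = 6`, `H` non-abelian) ∨ (`|H| = 8`, `H` of exponent `2`).
[cite: Yanai1985, §4 Theorem] [cite: Dodson1984, §3.1.1, §3.2.1 and §4.1] [cite: Gordon1999HodgeAVSurvey, §9.4.3] -/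
theorem forall_isPrimitive_isNondegenerate_iff_of_subgroup [IsGalois ℚ F] (H : Subgroup (F ≃ₐ[ℚ] F))
    (hcH : (IsCMField.complexConj F).restrictScalars ℚ ∉ H)
    (hH : ∀ g : F ≃ₐ[ℚ] F, g ∈ H ∨ (IsCMField.complexConj F).restrictScalars ℚ * g ∈ H) (φ₀ : F →+* ℂ) :
    (∀ Φ : CMType F, IsPrimitive (ℂ ≃+* ℂ) Φ.1 φ₀ → IsNondegenerate Φ) ↔
      ((Nat.card H).Prime ∨ Nat.card H = 1 ∨ Nat.card H = 4 ∨
        (Nat.card H = 6 ∧ ∃ a ∈ H, ∃ b ∈ H, a * b ≠ b * a) ∨ (Nat.card H = 8 ∧ ∀ h ∈ H, h * h = 1)) := by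
  obtain ⟨k, hfix, hk2, hkF, τ₀, hτ₀⟩ := exists_quadratic_of_subgroup H hcH hH
  rw [TwiceOdd.forall_isPrimitive_isNondegenerate_iff_of_quadratic k hk2 τ₀ hτ₀ φ₀, hkF, hfix]

/-! ### §1 From `φ : F →+* End⁰(X)` to a nondegenerate realisation in the isogeny class -/

/-- **Principal model with a nondegenerate type.**  `F/ℚ` Galois CM, `k ⊆ F` imaginary quadratic of GOOD type
(`[F:k]` prime ∨ `= 1` ∨ `= 4` ∨ (`= 6`, `Gal(F/k)` non-abelian) ∨ (`= 8`, `Gal(F/k)` of exponent `2`)); `X` a SIMPLE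
complex abelian variety of dimension `[F : k]` with `φ : F →+* End⁰(X)`.  Then some `X′` isogenous to `X` realises a
NONDEGENERATE CM type of `F`. [cite: Shimura1998, §7.1 Prop. 7 and §5.2] [cite: Gordon1999HodgeAVSurvey, §9.4] -/
theorem exists_isIsogenous_realisation_isNondegenerate_of_quadratic_of_good [IsGalois ℚ F]
    (k : IntermediateField ℚ F) (hk : Module.finrank ℚ k = 2) (τ₀ : k →+* ℂ)
    (hτ₀ : ComplexEmbedding.conjugate τ₀ ≠ τ₀)
    (hgood : (Module.finrank k F).Prime ∨ Module.finrank k F = 1 ∨ Module.finrank k F = 4 ∨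
      (Module.finrank k F = 6 ∧ ∃ a ∈ k.fixingSubgroup, ∃ b ∈ k.fixingSubgroup, a * b ≠ b * a) ∨
      (Module.finrank k F = 8 ∧ ∀ h ∈ k.fixingSubgroup, h * h = 1))
    {X : AbelianVariety ℂ} (hXs : X.IsSimple) (hXd : X.dim = Module.finrank k F) (φ : F →+* X.endAlgebra) :
    ∃ (X' : AbelianVariety ℂ) (Φ : CMType F) (ι : 𝓞 F →+* End X')
      (θ : F →+* Module.End ℂ (complexBetti X'.X 1)),
      IsIsogenous X X' ∧ IsCMTypeRealisation Φ X' ι θ ∧ IsNondegenerate Φ := by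
  obtain ⟨X', φ', ι', hφι, f, hf⟩ := exists_principal_pair φ
  have hF : Module.finrank ℚ F = 2 * Module.finrank k F := by
    rw [← Module.finrank_mul_finrank ℚ k F, hk]
  have hdim' : Module.finrank ℚ F = 2 * X'.dim := by rw [hF, ← dim_eq_of_isIsogeny hf, hXd]
  have hreal := isCMTypeRealisation_cmTypeOfPair φ' hdim' ι' hφι
  obtain ⟨s₀⟩ := (inferInstance : Nonempty (F →+* ℂ))
  exact ⟨X', _, ι', _, ⟨f, hf⟩, hreal, isNondegenerate_of_isPrimitive_of_quadratic_of_good k hk τ₀ hτ₀ hgood s₀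
    ((isSimple_iff_isPrimitive hreal s₀).1 (hXs.of_isIsogeny hf))⟩

/-! ### §2 The Hodge conjecture for everything isogenous to a power of `X` -/

/-- **`B = D` for every complex abelian variety isogenous to a power `X^{N+1}`** of a simple `X` of dimension `[F:k]`
with `φ : F →+* End⁰(X)`, `F ⊇ k` Galois CM of good type over the imaginary quadratic `k`.
[cite: Gordon1999HodgeAVSurvey, Thm. 6.4 and §9.4] [cite: vanGeemen1994HodgeAV, Lemma 3.7] -/
theorem isDivisorGenerated_of_isIsogenous_powSucc_of_ringHom_of_quadratic_of_good [IsGalois ℚ F]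
    (k : IntermediateField ℚ F) (hk : Module.finrank ℚ k = 2) (τ₀ : k →+* ℂ)
    (hτ₀ : ComplexEmbedding.conjugate τ₀ ≠ τ₀)
    (hgood : (Module.finrank k F).Prime ∨ Module.finrank k F = 1 ∨ Module.finrank k F = 4 ∨
      (Module.finrank k F = 6 ∧ ∃ a ∈ k.fixingSubgroup, ∃ b ∈ k.fixingSubgroup, a * b ≠ b * a) ∨
      (Module.finrank k F = 8 ∧ ∀ h ∈ k.fixingSubgroup, h * h = 1))
    {X : AbelianVariety ℂ} (hXs : X.IsSimple) (hXd : X.dim = Module.finrank k F) (φ : F →+* X.endAlgebra)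
    {B : AbelianVariety ℂ} {N : ℕ} (h : IsIsogenous B (X.powSucc N)) : IsDivisorGenerated B := by
  obtain ⟨X', Φ, ι, θ, hXX', hreal, hΦ⟩ :=
    exists_isIsogenous_realisation_isNondegenerate_of_quadratic_of_good k hk τ₀ hτ₀ hgood hXs hXd φ
  exact hΦ.isDivisorGenerated_of_isIsogenous_powSucc hreal (h.trans (isIsogenous_powSucc hXX' N))

/-- **The Hodge conjecture for every complex abelian variety isogenous to a power `X^{N+1}` of a SIMPLE abelian
variety `X` of dimension `[F:k]` carrying an action `φ : F →+* End⁰(X)` of a Galois CM field `F` containing an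
imaginary quadratic field `k` with `Gal(F/k) ∈ {1, C₂, C₂², C₄, C₂³, C_p, S₃}`** — UNCONDITIONALLY.
[cite: Gordon1999HodgeAVSurvey, Thm. 6.3–6.4 and §9.4] [cite: vanGeemen1994HodgeAV, Lemma 3.7] [cite: Deligne2000, §1] -/
theorem hodgeConjectureFor_of_isIsogenous_powSucc_of_ringHom_of_quadratic_of_good [IsGalois ℚ F]
    (k : IntermediateField ℚ F) (hk : Module.finrank ℚ k = 2) (τ₀ : k →+* ℂ)
    (hτ₀ : ComplexEmbedding.conjugate τ₀ ≠ τ₀)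
    (hgood : (Module.finrank k F).Prime ∨ Module.finrank k F = 1 ∨ Module.finrank k F = 4 ∨
      (Module.finrank k F = 6 ∧ ∃ a ∈ k.fixingSubgroup, ∃ b ∈ k.fixingSubgroup, a * b ≠ b * a) ∨
      (Module.finrank k F = 8 ∧ ∀ h ∈ k.fixingSubgroup, h * h = 1))
    {X : AbelianVariety ℂ} (hXs : X.IsSimple) (hXd : X.dim = Module.finrank k F) (φ : F →+* X.endAlgebra)
    {B : AbelianVariety ℂ} {N : ℕ} (h : IsIsogenous B (X.powSucc N)) : HodgeConjectureFor B.dim B.X :=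
  hodgeConjectureFor_of_isDivisorGenerated _
    (isDivisorGenerated_of_isIsogenous_powSucc_of_ringHom_of_quadratic_of_good k hk τ₀ hτ₀ hgood hXs hXd φ h)

/-- The variety itself (`N = 0`): **the Hodge conjecture for every simple abelian variety of dimension `[F:k]` with an
action of a Galois CM field `F ⊇ k` of good type.** [cite: Gordon1999HodgeAVSurvey, Thm. 6.3–6.4] [cite: Deligne2000, §1] -/
theorem hodgeConjectureFor_of_ringHom_of_quadratic_of_good [IsGalois ℚ F]
    (k : IntermediateField ℚ F) (hk : Module.finrank ℚ k = 2) (τ₀ : k →+* ℂ)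
    (hτ₀ : ComplexEmbedding.conjugate τ₀ ≠ τ₀)
    (hgood : (Module.finrank k F).Prime ∨ Module.finrank k F = 1 ∨ Module.finrank k F = 4 ∨
      (Module.finrank k F = 6 ∧ ∃ a ∈ k.fixingSubgroup, ∃ b ∈ k.fixingSubgroup, a * b ≠ b * a) ∨
      (Module.finrank k F = 8 ∧ ∀ h ∈ k.fixingSubgroup, h * h = 1))
    {X : AbelianVariety ℂ} (hXs : X.IsSimple) (hXd : X.dim = Module.finrank k F) (φ : F →+* X.endAlgebra) :
    HodgeConjectureFor X.dim X.X :=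
  hodgeConjectureFor_of_isIsogenous_powSucc_of_ringHom_of_quadratic_of_good k hk τ₀ hτ₀ hgood hXs hXd φ (N := 0)
    (IsIsogenous.refl X)

/-! ### §3 Class-target display (`HCOnClass`) -/

/-- **HC on the class «isogenous to a power of a simple abelian variety `X` with an action of a Galois CM field `F`
containing an imaginary quadratic field `k`, `dim X = [F : k]`, of good Galois type `Gal(F/k) ∈ {1, C₂, C₂², C₄, C₂³,
C_p, S₃}`»** (dimensions `[F:k]·(N+1)`), UNCONDITIONAL — a closed class target; by the classification of part IX the list
of Galois types is sharp. [cite: Gordon1999HodgeAVSurvey, Thm. 6.3–6.4 and §9.4] [cite: Deligne2000, §1] -/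
theorem hcOnClass_isIsogenous_powSucc_simple_galoisCM_imaginaryQuadratic_good :
    HCOnClass fun B ↦ ∃ (X : AbelianVariety ℂ) (N : ℕ) (F : Type) (_ : Field F) (_ : NumberField F)
      (_ : IsCMField F) (_ : IsGalois ℚ F) (k : IntermediateField ℚ F) (τ₀ : k →+* ℂ),
      Module.finrank ℚ k = 2 ∧ ComplexEmbedding.conjugate τ₀ ≠ τ₀ ∧
      ((Module.finrank k F).Prime ∨ Module.finrank k F = 1 ∨ Module.finrank k F = 4 ∨
        (Module.finrank k F = 6 ∧ ∃ a ∈ k.fixingSubgroup, ∃ b ∈ k.fixingSubgroup, a * b ≠ b * a) ∨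
        (Module.finrank k F = 8 ∧ ∀ h ∈ k.fixingSubgroup, h * h = 1)) ∧
      X.IsSimple ∧ X.dim = Module.finrank k F ∧ Nonempty (F →+* X.endAlgebra) ∧ IsIsogenous B (X.powSucc N) := by
  rintro B ⟨X, N, F, _, _, _, _, k, τ₀, hk, hτ₀, hgood, hXs, hXd, ⟨φ⟩, h⟩
  exact hodgeConjectureFor_of_isIsogenous_powSucc_of_ringHom_of_quadratic_of_good k hk τ₀ hτ₀ hgood hXs hXd φ h

end Summit.HodgeConjecture.CorCM.TwiceOdd

end
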